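import Literature.IUT.LogThetaLattice.MonoAnalyticLogShellVolumeOfTypeProofs
import Literature.IUT.LogThetaLattice.MonoAnalyticLogShellVolumeNegative
import HarnessLib

/-!
# [AbsTopIII] Corollary 5.10 (i), (iv)(d) at THE `p`-adic logarithm of a `p`-adic field, binder-free forms
# (D-0079 L-F sub-cell [AbsTop*]+[AbsAnab], `plan/L4/LF-ABSTOP.tsv` rows F-0160 `LogShellFiniteVolume`,
# F-0162 `MonoAnalyticLogShellVolume`, F-0163 `MonoAnalyticLogShellVolumeOfType`; worker abc-iut-w5-d246; proof-only, 0 `def`)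

S. Mochizuki, *Topics in absolute anabelian geometry III*, J. Math. Sci. Univ. Tokyo **22** (2015) 939–1156, Cor. 5.10
(i) p. 147, (iv)(d) p. 148, Prop. 5.8 (iii) p. 139 of the author's manuscript
[cite: MochizukiAbsTopIII2015, Cor 5.10 (iv)(d) p. 148].

The three rows are SCHEMATA over an abstract `p`-adic-logarithm structure `L : PadicLogOnUnits K` (and a free numerical type
`t : MLFType`); their universal closures are refuted in the tree (`exists_not_logShellFiniteVolume`,
`not_forall_monoAnalyticLogShellVolume`, `not_forall_monoAnalyticLogShellVolumeOfType`).  What print asserts is the instance at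
THE logarithm of an MLF — in the tree: abc-iut-S1's real `p`-adic logarithm packaged as `PadicLogOnUnits.ofUnitLog p K` for a
`p`-adic field `K` (a locally compact, ultrametric, normed `ℚ_p`-algebra field) — with the type `t` OF `K`.  Those instances are
theorems of abc-iut-L6-d2 / abc-iut-f-103 (`logShellFiniteVolume_ofUnitLog`; `monoAnalyticLogShellVolume_ofUnitLog_type`,
`monoAnalyticLogShellVolume_ofUnitLog_iff`; `monoAnalyticLogShellVolumeOfType_ofUnitLog (t) (hp) (hf) (he)`).  Recorded here, so
that each row has a closer with NO Prop binder at the genuine carrier (L-F head-match grammar, L4-lead m32 «the missing instances»):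

* F-0163: for EVERY fourth coordinate `m`, `MonoAnalyticLogShellVolumeOfType (ofUnitLog p K) (p, f_K, e_K, m)` — the repaired
  decl binds `m` to `K` itself (`MLFType.IsTorsionExpOf`), so at `(p, f_K, e_K)` OF `K` nothing remains to assume
  (`monoAnalyticLogShellVolumeOfType_ofUnitLog_typeOf`); and the conjunction of the three rows at THE type of `K`
  (`cor510_logShell_ofUnitLog_typeOf`: (i) finite log-volume ∧ (iv)(d) both readings).
* What stays refuted is only the FREE-parameter reading: a `t` whose `(p, f, e)` are not those of `K`
  (`exists_not_monoAnalyticLogShellVolumeOfType_padicThree`, abc-iut-L6 lineage) resp. whose `m ≠ m_K` for the unrepaired decl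
  (`not_forall_type_monoAnalyticLogShellVolume_ofUnitLog`).

Honest framing: assumption labels on OUR typed statements of a refereed 2015 result; PROVED = OUR kernel check of OUR instance form;
nothing here bears on, or takes a side on, [IUTchIII] Cor. 3.12.
-/

set_option autoImplicit false

noncomputable section

namespace Literature.IUT.LogThetaLattice

open Literature.AnabelianGeometry.AbsoluteAnabelian
open Literature.IUT.LogVolume (residueDegree absRamificationIdx torsionPExp)

variable (p : ℕ) [Fact p.Prime]
variable (K : Type*) [NontriviallyNormedField K] [NormedAlgebra ℚ_[p] K] [IsUltrametricDist K] [ProperSpace K]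
  [MeasurableSpace K] [BorelSpace K]

/-- **[AbsTopIII] Cor. 5.10 (iv)(d), repaired form (F-0163), AT THE `p`-adic logarithm of `K` and the type `(p, f_K, e_K, m)`
for EVERY `m`** — no Prop binder: the decl's own hypothesis `MLFType.IsTorsionExpOf` pins `m`; abc-iut-L6-d2's
`monoAnalyticLogShellVolumeOfType_ofUnitLog` with `hp hf he := rfl`. [cite: MochizukiAbsTopIII2015, Cor 5.10 (iv)(d) p. 148] -/
theorem monoAnalyticLogShellVolumeOfType_ofUnitLog_typeOf (m : ℕ) :
    Literature.AnabelianGeometry.AbsoluteAnabelian.MonoAnalyticLogShellVolumeOfType (PadicLogOnUnits.ofUnitLog p K)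
      ⟨p, Fact.out, residueDegree p K, LogVolume.residueDegree_pos p K, absRamificationIdx p K,
        LogVolume.absRamificationIdx_pos p K, m⟩ :=
  monoAnalyticLogShellVolumeOfType_ofUnitLog p K _ rfl rfl rfl

/-- **[AbsTopIII] Cor. 5.10 (i) ∧ (iv)(d) AT THE `p`-adic logarithm of `K` and THE type `(p, f_K, e_K, m_K)` of `K`**
(rows F-0160, F-0162, F-0163 together, no Prop binder): the log-shell `ℐ_K = (p*)⁻¹·log_p(𝒪_K^×)` is compact open (finite
log-volume) and its log-volume is the mono-analytically reconstructed value `{-1 - m/f + e·log(p*)/log p}·(f·log p)` of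
Prop. 5.8 (iii), in both the unrepaired and the repaired reading — `logShellFiniteVolume_ofUnitLog`,
`monoAnalyticLogShellVolume_ofUnitLog_type` (abc-iut-f-103), and the previous theorem at `m := m_K`.
[cite: MochizukiAbsTopIII2015, Cor 5.10 (i) p. 147] -/
theorem cor510_logShell_ofUnitLog_typeOf :
    Literature.AnabelianGeometry.AbsoluteAnabelian.LogShellFiniteVolume (PadicLogOnUnits.ofUnitLog p K) ∧
      Literature.AnabelianGeometry.AbsoluteAnabelian.MonoAnalyticLogShellVolume (PadicLogOnUnits.ofUnitLog p K)
        ⟨p, Fact.out, residueDegree p K, LogVolume.residueDegree_pos p K, absRamificationIdx p K,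
          LogVolume.absRamificationIdx_pos p K, torsionPExp p K⟩ ∧
      Literature.AnabelianGeometry.AbsoluteAnabelian.MonoAnalyticLogShellVolumeOfType (PadicLogOnUnits.ofUnitLog p K)
        ⟨p, Fact.out, residueDegree p K, LogVolume.residueDegree_pos p K, absRamificationIdx p K,
          LogVolume.absRamificationIdx_pos p K, torsionPExp p K⟩ :=
  ⟨logShellFiniteVolume_ofUnitLog p K, monoAnalyticLogShellVolume_ofUnitLog_type p K,
    monoAnalyticLogShellVolumeOfType_ofUnitLog_typeOf p K (torsionPExp p K)⟩

end Literature.IUT.LogThetaLattice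

end
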